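import Literature.MathematicalPhysics.QuantumFieldTheory.Balaban1983to89.B9SectBH1GReadWriteY

/-!
# `Balaban1983to89.B9SectBE4H2GReadWriteY` — THE (3.44) ∕ (3.45) BOND-SECTOR READINGS OF AN OPERATOR `T` IN THE LETTERS OF `U` (Thm 3.3's `G`, Thm 3.4's `G(U′U)`):
# `e4ReadB` (the sup entry `∇_{U,ν}T∇*_{U,μ}Λ` on a block), `h2ReadB` (its covariant bond Hölder quotient), their `rfl` bridges to `KACU.e4 ∕ .h2` and the READ ∕ WRITE
# dictionary (pub-ymgap N06 row 13, G side: the (3.44) ∕ (3.45) members of `B9SectBCodedReadingsU.SectBStepU`)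

T. Bałaban, *Propagators for lattice gauge theories in a background field*, Commun. Math. Phys. **99** (1985) 389–434
[`Balaban1985BackgroundPropagators`, "B9"]; [4] = T. Bałaban, *Propagators and renormalization transformations for lattice gauge
theories. II*, Commun. Math. Phys. **96** (1984) 223–250 [`Balaban1984PropagatorsII`].

statement-level skeleton of published theorems with citation tags; proofs where landed; nothing here is a claim about the
Yang–Mills mass gap

THE PRINTED LOCI.  (3.44) p. 398 (`|∇_U G∇*_Uλ(x)| ≦ B′₀(ε)e^{−δ₀d(y,y′)}(‖λ‖_ε + |λ|)`, `x ∈ Δ(y)`), (3.45) p. 398 (`‖ζ∇_U G∇*_Uλ‖_β ≦ B′₀(ε,β)(Lʲη)^{−β}(‖ζ‖_β + |ζ|)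
e^{−δ₀d(y,y′)}(‖λ‖_{β+ε} + |λ|)`), read for Thm 3.3's `G` (p. 399) and Thm 3.4's `G(U′U)` in the norms OF `U` (p. 400, p. 403 l. 2–5); (3.39)–(3.40) p. 397; [4] (2.137)
p. 247, (2.51)–(2.52) p. 232.

WHY THIS FILE (seat dag-n06-c gen 14; the (3.44)∕(3.45) members of the G side of row 13, R13-U1).  def-Y's bond reading `Node00.OpsYULetters.kernelFamilyBU` reads
(3.44) as `⨆_{‖E‖≤1} ⨆_ν ⨆_μ supInB (βy) (∇_{U,ν}(T(∇*_{U,μ}(J ⊗ E))))` and (3.45) as `⨆_{‖E‖≤1} ⨆_ν ⨆_μ holderQB (par U) α ζ (∇_{U,ν}(T(∇*_{U,μ}(J ⊗ E))))`; the transfer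
field `B9SectBE4H2GFrameV6.E4H2GFrame₆.e4h2G_transfer` speaks of the coordinates ∕ pair probes of the triple letter product `D_l·Gb·D_s μ`.  THIS FILE is the reading
side (bond twin of gen 12's `B9SectBE4FrameCodedY.e4_read` ∕ `B9SectBH2FrameCodedY.h2_read`): §1 ★ `e4ReadB`, ★ `h2ReadB`, the `rfl` bridges `KACU_e4_inr_eq`,
`KACU_h2_inr_eq` and the off-sector zeros; §2 the double word `∇_{U,ν} ∘ T ∘ ∇*_{U,μ}` as a real-linear map and its uniform bounds over the unit ball by basis
decomposition (`norm_word_liftY_le`, `supInB_word_liftY_le`; the Hölder one is gen 14's `holderQB_liftY_le_sum`); §3 READ (`norm_le_e4ReadB`, `probe_le_h2ReadB`);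
§4 WRITE (`e4ReadB_le_of_forall`, `h2ReadB_le_of_probes`).
HONEST SCOPE.  Definitions and `⨆` bookkeeping over def-Y's readers; nothing of [B9] asserted; COUNT-NEUTRAL; N06 NOT discharged; one finite lattice programme at fixed
ε — nothing continuum, nothing about OS positivity or the mass gap.  No `sorry`, no `axiom`, no `instance`, no `notation`.  Seat `pub-ymgap-dag-n06-c` (g14),
2026-08-29; `--supports stmt-QuantumFields-27364`.

RELATED IN THE TREE, NOT DUPLICATED: `B9SectBH1GReadWriteY` (gen 14, the (3.43) twin — USED: `probeB`, `holderQB_liftY_le_sum`, `word_liftY_eq_sum`),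
`B9CubeLettersInvReadDictB` (`supInB_le`, `norm_le_supInB` — USED), `B9Thm314WholeExpansionReads.le_iSup_ball_iSup₂` (USED), `Node00.OpsYULetters`.
-/

noncomputable section

namespace Literature.MathematicalPhysics.QuantumFieldTheory.Balaban1983to89.B9SectBE4H2GReadWriteY

open LatticeFieldCalculus (supDist)
open B9Eq39Adjoint (R)
open B6GlobalChartV1 (PV blkV1)
open B6Ineq2142KLevelV1 (β)
open B6KLevelCensusIndexV1 (KIdx Adm)
open B9CoReadingCoords (cdBₗ cdsBₗ cdBₗ_apply cdsBₗ_apply)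
open B9CubeLettersInvReadDictB (supInB_le norm_le_supInB supInB_nonneg)
open B9PinMembersKLevelV1 (MemberY geo9Y)
open B9Eq360DeltaPrimeAY (AfldY)
open B9SectBGpFrameCodedY (codingYx)
open B9SectBGpReadingsY (baseY)
open B9SectBGpLettersY (decY)
open B9SectBCodedReadingsU (KACU)
open Node00 (SiteY BlkY FBondY IBondY CfgY BallY BondOpY BondParY liftY liftY_apply holderQB supInB cdB cdsB iSup_ball_le)
open Node00.OpsYHolderFar (holderQB_nonneg)
open B9Thm314WholeExpansionReads (le_iSup_ball_iSup₂)
open B9SectBH1GReadWriteY (probeB norm_probeB norm_probeB_le_holderQB holderQB_le_of_probeB holderQB_liftY_le_sum word_liftY_eq_sum)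

variable {d ℓ : ℕ} {hd : 1 ≤ d + 1} {hL : Odd (ℓ + 1) ∧ 1 < ℓ + 1} {b₀ b₁ : ℝ}
variable {𝔸 : Type} [NormedRing 𝔸] [NormedAlgebra ℂ 𝔸] [CompleteSpace 𝔸]
variable (i : KIdx d ℓ hd hL b₀ b₁)

/-! ## §1 The two readings and their bridges to `KACU` -/

/-- ★ **THE (3.44) BOND READING OF A FIXED OPERATOR `T` IN THE LETTERS OF `U`** on the block `s`: `⨆_{‖E‖≤1} ⨆_ν ⨆_μ sup_{x ∈ Δ(s)} ‖(∇_{U,ν}(T(∇*_{U,μ}(J ⊗ E))))(x)‖`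
— def-Y's `kernelFamilyBU….e4` when `T = O (cfgW U′)`, `U = cfgU U′`. [cite: Balaban1985BackgroundPropagators, (3.44) p.398 with Thm 3.3 p.399, Thm 3.4 p.400] -/
def e4ReadB (T : (FBondY i → 𝔸) →ₗ[ℂ] (FBondY i → 𝔸)) (U : CfgY 𝔸 i) (J : FBondY i → ℝ) (s : BlkY i) : ℝ :=
  ⨆ E : BallY 𝔸, ⨆ ν : Fin (d + 1), ⨆ μ : Fin (d + 1), supInB i s (cdB i U ν (T (cdsB i U μ (liftY J (E : 𝔸)))))

/-- ★ **THE (3.45) BOND READING OF A FIXED OPERATOR `T` IN THE LETTERS OF `U` WITH THE TRANSPORTER `par`**: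
`⨆_{‖E‖≤1} ⨆_ν ⨆_μ holderQB par α ζ (∇_{U,ν}(T(∇*_{U,μ}(J ⊗ E))))`. [cite: Balaban1985BackgroundPropagators, (3.45) p.398 with Thm 3.3 p.399, (3.40) p.397, Thm 3.4 p.400] -/
def h2ReadB (T : (FBondY i → 𝔸) →ₗ[ℂ] (FBondY i → 𝔸)) (par : Site (PV d ℓ i.m i.K hd hL) 0 → Site (PV d ℓ i.m i.K hd hL) 0 → 𝔸ˣ) (U : CfgY 𝔸 i)
    (J : FBondY i → ℝ) (α : ℝ) (ζ : FBondY i → ℝ) : ℝ :=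
  ⨆ E : BallY 𝔸, ⨆ ν : Fin (d + 1), ⨆ μ : Fin (d + 1), holderQB i par α ζ (cdB i U ν (T (cdsB i U μ (liftY J (E : 𝔸)))))

section KACUFaces

variable {Mstar : ℕ} (G : Subgroup 𝔸ˣ) (x : MemberY d ℓ hd hL b₀ b₁ Mstar) (OA : BondOpY 𝔸 x.toKIdx) (parB : BondParY 𝔸 x.toKIdx)
  (C37 C38 : ℝ → CfgY 𝔸 x.toKIdx → AfldY 𝔸 x.toKIdx → Prop)

/-- ★ the (3.44) member of `KACU` at a coded configuration: the reading of `OA (dec c)` in the letters of `base c` on the block of `y` (`rfl`).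
[cite: Balaban1985BackgroundPropagators, (3.44) p.398, Thm 3.4 p.400, bookkeeping] -/
theorem KACU_e4_inr_eq (c : (codingYx G x C37 C38).bg.Cfg) (J : FBondY x.toKIdx → ℝ) (y : IBondY x.toKIdx) :
    (KACU G x OA parB C37 C38).e4 c (.inr J) y =
      e4ReadB x.toKIdx (OA (decY x.toKIdx c)) (baseY x.toKIdx c) J (β x.toKIdx.hN x.toKIdx.D x.toKIdx.hk y) := rfl

/-- the (3.44) member of `KACU` vanishes on site-sector arguments (`rfl`). [cite: Balaban1985BackgroundPropagators, (3.44) p.398, bookkeeping] -/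
theorem KACU_e4_inl (c : (codingYx G x C37 C38).bg.Cfg) (f : SiteY x.toKIdx → ℝ) (y : IBondY x.toKIdx) : (KACU G x OA parB C37 C38).e4 c (.inl f) y = 0 := rfl

/-- ★ the (3.45) member of `KACU` at a coded configuration: the reading of `OA (dec c)` with the transporter and letters of `base c` (`rfl`).
[cite: Balaban1985BackgroundPropagators, (3.45) p.398, Thm 3.4 p.400, bookkeeping] -/
theorem KACU_h2_inr_eq (c : (codingYx G x C37 C38).bg.Cfg) (J : FBondY x.toKIdx → ℝ) (α : ℝ) (z : FBondY x.toKIdx → ℝ) :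
    (KACU G x OA parB C37 C38).h2 c (.inr J) α (.inr z) =
      h2ReadB x.toKIdx (OA (decY x.toKIdx c)) (parB (baseY x.toKIdx c)) (baseY x.toKIdx c) J α z := rfl

/-- the (3.45) member of `KACU` vanishes OFF the (bond argument, bond cut-off) sector (`rfl` ×3). [cite: Balaban1985BackgroundPropagators, (3.45) p.398, bookkeeping] -/
theorem KACU_h2_off (c : (codingYx G x C37 C38).bg.Cfg) (α : ℝ) :
    (∀ (J : FBondY x.toKIdx → ℝ) (zs : SiteY x.toKIdx → ℝ), (KACU G x OA parB C37 C38).h2 c (.inr J) α (.inl zs) = 0) ∧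
    (∀ (f : SiteY x.toKIdx → ℝ) (ζ : (geo9Y x).Cut), (KACU G x OA parB C37 C38).h2 c (.inl f) α ζ = 0) := by
  refine ⟨fun J zs => rfl, fun f ζ => ?_⟩
  rcases ζ with z | z <;> rfl

end KACUFaces

/-! ## §2 The double word as a real-linear map; uniform bounds over the unit ball -/

section Word

variable {ι : Type} [Fintype ι] (b : Module.Basis ι ℝ 𝔸) (T : (FBondY i → 𝔸) →ₗ[ℂ] (FBondY i → 𝔸)) (U : CfgY 𝔸 i)

/-- the double word `∇_{U,ν} ∘ T ∘ ∇*_{U,μ}` as a real-linear map, applied. [cite: Balaban1985BackgroundPropagators, (3.44) p.398, bookkeeping] -/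
theorem wordLR_apply (ν μ : Fin (d + 1)) (Λ : FBondY i → 𝔸) :
    (cdBₗ i U ν ∘ₗ T.restrictScalars ℝ ∘ₗ cdsBₗ i U μ) Λ = cdB i U ν (T (cdsB i U μ Λ)) := rfl

omit [CompleteSpace 𝔸] in
/-- a real-linear word at `J ⊗ E` against the basis directions, pointwise: `‖W(J ⊗ E)(q)‖ ≤ M₂‖E‖·Σ_j ‖W(J ⊗ b_j)(q)‖`.
[cite: Balaban1985BackgroundPropagators, (3.39) p.397, bookkeeping] -/
theorem norm_word_liftY_le (W : (FBondY i → 𝔸) →ₗ[ℝ] (FBondY i → 𝔸)) {M₂ : ℝ} (hrepr : ∀ (v : 𝔸) (j : ι), |b.repr v j| ≤ M₂ * ‖v‖)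
    (J : FBondY i → ℝ) (E : 𝔸) (q : FBondY i) : ‖W (liftY J E) q‖ ≤ M₂ * ‖E‖ * ∑ j, ‖W (liftY J (b j)) q‖ := by
  rw [word_liftY_eq_sum i b W J E, Finset.sum_apply, Finset.mul_sum]
  refine (norm_sum_le _ _).trans (Finset.sum_le_sum fun j _ => ?_)
  rw [Pi.smul_apply, norm_smul, Real.norm_eq_abs]
  exact mul_le_mul_of_nonneg_right (hrepr E j) (norm_nonneg _)

omit [CompleteSpace 𝔸] in
/-- a UNIFORM bound of the block sup of a word over the unit ball: `supInB s (W(J ⊗ E)) ≤ M₂·Σ_j supInB s (W(J ⊗ b_j))` for `‖E‖ ≤ 1`.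
[cite: Balaban1985BackgroundPropagators, (3.44) p.398 (sup over |λ| ≤ 1), bookkeeping] -/
theorem supInB_word_liftY_le (W : (FBondY i → 𝔸) →ₗ[ℝ] (FBondY i → 𝔸)) {M₂ : ℝ} (hM₂ : 0 ≤ M₂) (hrepr : ∀ (v : 𝔸) (j : ι), |b.repr v j| ≤ M₂ * ‖v‖)
    (J : FBondY i → ℝ) (s : BlkY i) {E : 𝔸} (hE : ‖E‖ ≤ 1) : supInB i s (W (liftY J E)) ≤ M₂ * ∑ j, supInB i s (W (liftY J (b j))) := by
  have hS : 0 ≤ ∑ j, supInB i s (W (liftY J (b j))) := Finset.sum_nonneg fun j _ => supInB_nonneg i s _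
  refine supInB_le i s _ (mul_nonneg hM₂ hS) fun q hq => ?_
  refine (norm_word_liftY_le i b W hrepr J E q).trans ?_
  calc M₂ * ‖E‖ * ∑ j, ‖W (liftY J (b j)) q‖ ≤ M₂ * 1 * ∑ j, supInB i s (W (liftY J (b j))) := by
        refine mul_le_mul (mul_le_mul_of_nonneg_left hE hM₂) (Finset.sum_le_sum fun j _ => norm_le_supInB i s _ hq)
          (Finset.sum_nonneg fun j _ => norm_nonneg _) (mul_nonneg hM₂ zero_le_one)
    _ = M₂ * ∑ j, supInB i s (W (liftY J (b j))) := by rw [mul_one]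

/-- the uniform bounds of the (3.44) reader's integrand over the unit ball, per pair of directions. [cite: Balaban1985BackgroundPropagators, (3.44) p.398, bookkeeping] -/
theorem exists_bound_ball_e4 {M₂ : ℝ} (hM₂ : 0 ≤ M₂) (hrepr : ∀ (v : 𝔸) (j : ι), |b.repr v j| ≤ M₂ * ‖v‖) (J : FBondY i → ℝ) (s : BlkY i) :
    ∀ ν μ : Fin (d + 1), ∃ C : ℝ, ∀ E : BallY 𝔸, supInB i s (cdB i U ν (T (cdsB i U μ (liftY J (E : 𝔸))))) ≤ C := fun ν μ =>
  ⟨M₂ * ∑ j, supInB i s (cdB i U ν (T (cdsB i U μ (liftY J (b j))))), fun E =>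
    supInB_word_liftY_le i b (cdBₗ i U ν ∘ₗ T.restrictScalars ℝ ∘ₗ cdsBₗ i U μ) hM₂ hrepr J s (mem_closedBall_zero_iff.1 E.2)⟩

variable (par : Site (PV d ℓ i.m i.K hd hL) 0 → Site (PV d ℓ i.m i.K hd hL) 0 → 𝔸ˣ)

/-- the uniform bounds of the (3.45) reader's integrand over the unit ball, per pair of directions. [cite: Balaban1985BackgroundPropagators, (3.45) p.398, bookkeeping] -/
theorem exists_bound_ball_h2 {M₂ : ℝ} (hM₂ : 0 ≤ M₂) (hrepr : ∀ (v : 𝔸) (j : ι), |b.repr v j| ≤ M₂ * ‖v‖) (J : FBondY i → ℝ) (α : ℝ) (ζ : FBondY i → ℝ) :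
    ∀ ν μ : Fin (d + 1), ∃ C : ℝ, ∀ E : BallY 𝔸, holderQB i par α ζ (cdB i U ν (T (cdsB i U μ (liftY J (E : 𝔸))))) ≤ C := fun ν μ =>
  ⟨M₂ * ∑ j, holderQB i par α ζ (cdB i U ν (T (cdsB i U μ (liftY J (b j))))), fun E =>
    holderQB_liftY_le_sum i b par (cdBₗ i U ν ∘ₗ T.restrictScalars ℝ ∘ₗ cdsBₗ i U μ) α ζ hM₂ hrepr J (mem_closedBall_zero_iff.1 E.2)⟩

/-! ## §3 READ -/

/-- ★ **READ, (3.44)**: `‖(∇_{U,ν}T∇*_{U,μ}(J ⊗ E))(q)‖ ≤ e4ReadB T U J s` for `q ∈ Δ(s)`, `‖E‖ ≤ 1`. [cite: Balaban1985BackgroundPropagators, (3.44) p.398, Thm 3.3 p.399] -/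
theorem norm_le_e4ReadB {M₂ : ℝ} (hM₂ : 0 ≤ M₂) (hrepr : ∀ (v : 𝔸) (j : ι), |b.repr v j| ≤ M₂ * ‖v‖) (J : FBondY i → ℝ) (s : BlkY i) (E : BallY 𝔸)
    (ν μ : Fin (d + 1)) {q : FBondY i} (hq : blkV1 i.hN i.D q = s) : ‖cdB i U ν (T (cdsB i U μ (liftY J (E : 𝔸)))) q‖ ≤ e4ReadB i T U J s := by
  unfold e4ReadB
  exact (norm_le_supInB i s _ hq).trans (le_iSup_ball_iSup₂ (exists_bound_ball_e4 i b T U hM₂ hrepr J s) E ν μ)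

/-- ★ **READ, (3.45)**: every ADMISSIBLE pair probe of `∇_{U,ν}T∇*_{U,μ}(J ⊗ E)` is below the reading, `‖E‖ ≤ 1`.
[cite: Balaban1985BackgroundPropagators, (3.45) p.398, (3.40) p.397, Thm 3.3 p.399] -/
theorem probe_le_h2ReadB {M₂ : ℝ} (hM₂ : 0 ≤ M₂) (hrepr : ∀ (v : 𝔸) (j : ι), |b.repr v j| ≤ M₂ * ‖v‖) (J : FBondY i → ℝ) (α : ℝ) (ζ : FBondY i → ℝ)
    (E : BallY 𝔸) (ν μ : Fin (d + 1)) {q q' : FBondY i} (hadm : Adm i q q') :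
    ‖probeB i par α ζ q q' (cdB i U ν (T (cdsB i U μ (liftY J (E : 𝔸)))))‖ ≤ h2ReadB i T par U J α ζ := by
  unfold h2ReadB
  exact (norm_probeB_le_holderQB i par α ζ _ hadm).trans (le_iSup_ball_iSup₂ (exists_bound_ball_h2 i b T U par hM₂ hrepr J α ζ) E ν μ)

end Word

/-! ## §4 WRITE -/

/-- `0 ≤ e4ReadB`. [cite: Balaban1985BackgroundPropagators, (3.44) p.398, bookkeeping] -/
theorem e4ReadB_nonneg (T : (FBondY i → 𝔸) →ₗ[ℂ] (FBondY i → 𝔸)) (U : CfgY 𝔸 i) (J : FBondY i → ℝ) (s : BlkY i) : 0 ≤ e4ReadB i T U J s :=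
  Real.iSup_nonneg fun _ => Real.iSup_nonneg fun _ => Real.iSup_nonneg fun _ => supInB_nonneg i s _

/-- `0 ≤ h2ReadB`. [cite: Balaban1985BackgroundPropagators, (3.45) p.398, bookkeeping] -/
theorem h2ReadB_nonneg (T : (FBondY i → 𝔸) →ₗ[ℂ] (FBondY i → 𝔸)) (par : Site (PV d ℓ i.m i.K hd hL) 0 → Site (PV d ℓ i.m i.K hd hL) 0 → 𝔸ˣ)
    (U : CfgY 𝔸 i) (J : FBondY i → ℝ) (α : ℝ) (ζ : FBondY i → ℝ) : 0 ≤ h2ReadB i T par U J α ζ :=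
  Real.iSup_nonneg fun _ => Real.iSup_nonneg fun _ => Real.iSup_nonneg fun _ => holderQB_nonneg i par α ζ _

/-- ★★ **WRITE, (3.44)**: a bound `B ≥ 0` on every `‖(∇_{U,ν}T∇*_{U,μ}(J ⊗ E))(q)‖`, `q ∈ Δ(s)`, `‖E‖ ≤ 1`, bounds `e4ReadB T U J s`.
[cite: Balaban1985BackgroundPropagators, (3.44) p.398, Thm 3.4 p.400] -/
theorem e4ReadB_le_of_forall (T : (FBondY i → 𝔸) →ₗ[ℂ] (FBondY i → 𝔸)) (U : CfgY 𝔸 i) (J : FBondY i → ℝ) (s : BlkY i) {B : ℝ} (hB : 0 ≤ B)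
    (h : ∀ (E : BallY 𝔸) (ν μ : Fin (d + 1)) (q : FBondY i), blkV1 i.hN i.D q = s → ‖cdB i U ν (T (cdsB i U μ (liftY J (E : 𝔸)))) q‖ ≤ B) :
    e4ReadB i T U J s ≤ B :=
  iSup_ball_le (fun E => Real.iSup_le (fun ν => Real.iSup_le (fun μ => supInB_le i s _ hB fun q hq => h E ν μ q hq) hB) hB) hB

/-- ★★ **WRITE, (3.45)**: a bound `B ≥ 0` on every ADMISSIBLE pair probe of every `∇_{U,ν}T∇*_{U,μ}(J ⊗ E)`, `‖E‖ ≤ 1`, bounds `h2ReadB T par U J α ζ`.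
[cite: Balaban1985BackgroundPropagators, (3.45) p.398, (3.40) p.397, Thm 3.4 p.400; Balaban1984PropagatorsII, (2.137) p.247] -/
theorem h2ReadB_le_of_probes (T : (FBondY i → 𝔸) →ₗ[ℂ] (FBondY i → 𝔸)) (par : Site (PV d ℓ i.m i.K hd hL) 0 → Site (PV d ℓ i.m i.K hd hL) 0 → 𝔸ˣ)
    (U : CfgY 𝔸 i) (J : FBondY i → ℝ) (α : ℝ) (ζ : FBondY i → ℝ) {B : ℝ} (hB : 0 ≤ B)
    (h : ∀ (E : BallY 𝔸) (ν μ : Fin (d + 1)) (q q' : FBondY i), Adm i q q' → ‖probeB i par α ζ q q' (cdB i U ν (T (cdsB i U μ (liftY J (E : 𝔸)))))‖ ≤ B) :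
    h2ReadB i T par U J α ζ ≤ B :=
  iSup_ball_le (fun E => Real.iSup_le (fun ν => Real.iSup_le (fun μ => holderQB_le_of_probeB i par α ζ _ hB fun q q' hq => h E ν μ q q' hq) hB) hB) hB

end Literature.MathematicalPhysics.QuantumFieldTheory.Balaban1983to89.B9SectBE4H2GReadWriteY

end
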